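import Summits.MatrixMultiplication.OmegaCensus.STPPSmallPatternT2Below30
import Summits.MatrixMultiplication.OmegaCensus.STPPSmallPatternNone122K4Z30
import Summits.MatrixMultiplication.OmegaCensus.STPPSmallPatternNone122K4Z31

/-!
# ω-census, small STPP pattern `(1,2,2)^k`: THE ONSET OF `(1,2,2)⁴` OVER ALL FINITE ABELIAN GROUPS IS `32` EXACTLY (kernel)

HONEST FRAMING (pub-omega census; verbatim): lottery ticket; floor = certified bounds/negative ranges.
Census STRUCTURE bookkeeping of the STPP track (seat pub-omega-stpp-3, gen 24; STRUCTURE row B5: the threshold column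
`T2(H) = max {k : (1,2,2)^k ⊆ H}` and the LIFT-TIGHT law `onset_T2(k) = 2 · onset_T1(k)`, here `k = 4`: `32 = 2 · 16`), not progress
on `ω`: small patterns in small groups bound no exponent.

Extension of `STPPSmallPatternT2Below30.lean` by the two abelian groups of order `30` and `31` (`ℤ/30`, `ℤ/31`; kernel cells of gen 24,
`B ↔ C`-duality-reduced starts all split at the second level, `STPPSmallPatternKernelSearch122B.lean`):
* `not_exists_isSTPP_122pow4_of_card_le_31` — **no finite abelian group of order `≤ 31` admits an STPP family of size pattern `(1,2,2)⁴`**;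
* `stpp122pow4_onset_eq_32` — with the order-`32` host `ℤ/2 × ℤ/16` (`STPPSmallPatternT2K4Order32.lean`, ENG2): **the all-abelian onset of
  `(1,2,2)⁴` is `32` EXACTLY** (kernel both ways; the engines' value, ×2).  The cyclic onset is `33` by the engines (`ℤ/33` hosts:
  `exists_isSTPP_122pow4_zmod33`; `ℤ/32` is not a kernel cell).
* `stpp122_T2_eq_3_orders_30_31` — `T2 = 3` exactly at `ℤ/30`, `ℤ/31`.

References: H. Cohn, R. Kleinberg, B. Szegedy, C. Umans, FOCS 2005 (arXiv:math/0511460), Def. 5.1.  Record: pub-omega HOME `pub-omega-stpp-3-g24/`.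
-/

open Literature.Computability.AlgebraicComplexity Finset

namespace Summit.MatrixMultiplication.OmegaCensus

/-- A `(1,2,2)^k` exclusion for `ℤ/(a b)` (`a`, `b` coprime) read on `ℤ/a × ℤ/b` (CRT). [cite: CohnKleinbergSzegedyUmans2005, Def. 5.1] -/
theorem not_exists_isSTPP_122_prod_of_zmod_mul {a b k : ℕ} (h : a.Coprime b)
    (hneg : ¬ ∃ A B C : Fin k → Finset (ZMod (a * b)), IsSTPP A B C ∧ ∀ i, (A i).card = 1 ∧ (B i).card = 2 ∧ (C i).card = 2) :
    ¬ ∃ A B C : Fin k → Finset (ZMod a × ZMod b), IsSTPP A B C ∧ ∀ i, (A i).card = 1 ∧ (B i).card = 2 ∧ (C i).card = 2 :=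
  fun hex => hneg (exists_isSTPP_122_of_injective (ZMod.chineseRemainder h).toAddEquiv.symm.toAddMonoidHom
    (AddEquiv.injective _) hex)

/-- COMBINATORIAL CORE for `k = 4`, orders `≤ 31` (kernel). -/
theorem noneList122K4c_of_capped : ∀ E ∈ List.range' 1 31, ∀ M ∈ subMS (capList E), 2 * 4 ≤ M.prod → M.prod ≤ 31 →
    ∃ s ∈ (((noneLists122K3 ++ [[8, 3], [2, 4, 3], [2, 2, 2, 3], [25], [5, 5], [2, 13], [27], [3, 9], [3, 3, 3]]) ++
      [[4, 7], [2, 2, 7], [29]]) ++ [[2, 3, 5], [31]]), dom s M = true ∧ s.prod = M.prod := by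
  decide +kernel

/-- Each listed group admits no `(1,2,2)⁴`. [cite: CohnKleinbergSzegedyUmans2005, Def. 5.1] -/
theorem not_122pow4_of_mem_noneLists122K4c :
    ∀ s ∈ (((noneLists122K3 ++ [[8, 3], [2, 4, 3], [2, 2, 2, 3], [25], [5, 5], [2, 13], [27], [3, 9], [3, 3, 3]]) ++
      [[4, 7], [2, 2, 7], [29]]) ++ [[2, 3, 5], [31]]),
    ¬ ∃ A B C : Fin 4 → Finset (SeedType s), IsSTPP A B C ∧ ∀ i, (A i).card = 1 ∧ (B i).card = 2 ∧ (C i).card = 2 := by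
  intro s hs
  rcases List.mem_append.1 hs with hs5 | hs6
  · exact not_122pow4_of_mem_noneLists122K4b s hs5
  simp only [List.mem_cons, List.mem_nil_iff, or_false] at hs6
  rcases hs6 with rfl | rfl
  · exact not_exists_isSTPP_122_seedConsPair (by norm_num)
      (not_exists_isSTPP_122_prod_of_zmod_mul (by norm_num) not_exists_isSTPP_122pow4_zmod30)
  · exact not_exists_isSTPP_122pow4_zmod31

/-- **No finite abelian group of order `≤ 31` admits an STPP family of size pattern `(1,2,2)⁴`** (CKSU Def. 5.1, tree `IsSTPP`;
kernel).  No `ω` bound follows. [cite: CohnKleinbergSzegedyUmans2005, Def. 5.1] -/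
theorem not_exists_isSTPP_122pow4_of_card_le_31 {G : Type*} [AddCommGroup G] [Finite G] (hG : Nat.card G ≤ 31) :
    ¬ ∃ A B C : Fin 4 → Finset G, IsSTPP A B C ∧ ∀ i, (A i).card = 1 ∧ (B i).card = 2 ∧ (C i).card = 2 :=
  not_exists_isSTPP_122_of_card_le_hi45 (by norm_num) noneList122K4c_of_capped not_122pow4_of_mem_noneLists122K4c hG

/-- **THE ALL-ABELIAN ONSET OF `(1,2,2)⁴` IS `32` EXACTLY** (kernel both ways): no finite abelian group of order `≤ 31` hosts, and
`ℤ/2 × ℤ/16` (order `32`) hosts.  (`32 = 2 · 16 = 2 · onset_T1(4)`: the lift-tight law of STRUCTURE B5 at `k = 4`.)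
[cite: CohnKleinbergSzegedyUmans2005, Def. 5.1] -/
theorem stpp122pow4_onset_eq_32 :
    (∀ (G : Type) [AddCommGroup G] [Finite G], Nat.card G ≤ 31 →
      ¬ ∃ A B C : Fin 4 → Finset G, IsSTPP A B C ∧ ∀ i, (A i).card = 1 ∧ (B i).card = 2 ∧ (C i).card = 2) ∧
    ∃ A B C : Fin 4 → Finset (ZMod 2 × ZMod 16), IsSTPP A B C ∧ ∀ i, (A i).card = 1 ∧ (B i).card = 2 ∧ (C i).card = 2 :=
  ⟨fun _ _ _ hG => not_exists_isSTPP_122pow4_of_card_le_31 hG, exists_isSTPP_122pow4_zmod2_zmod16⟩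

/-- **`T2 = 3` EXACTLY at `ℤ/30`, `ℤ/31`** (kernel both ways). [cite: CohnKleinbergSzegedyUmans2005, Def. 5.1] -/
theorem stpp122_T2_eq_3_orders_30_31 :
    ((∃ A B C : Fin 3 → Finset (ZMod 30), IsSTPP A B C ∧ ∀ i, (A i).card = 1 ∧ (B i).card = 2 ∧ (C i).card = 2) ∧
      ¬ ∃ A B C : Fin 4 → Finset (ZMod 30), IsSTPP A B C ∧ ∀ i, (A i).card = 1 ∧ (B i).card = 2 ∧ (C i).card = 2) ∧
    ((∃ A B C : Fin 3 → Finset (ZMod 31), IsSTPP A B C ∧ ∀ i, (A i).card = 1 ∧ (B i).card = 2 ∧ (C i).card = 2) ∧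
      ¬ ∃ A B C : Fin 4 → Finset (ZMod 31), IsSTPP A B C ∧ ∀ i, (A i).card = 1 ∧ (B i).card = 2 ∧ (C i).card = 2) :=
  ⟨stpp122_T2_zmod30_eq_3, stpp122_T2_zmod31_eq_3⟩

end Summit.MatrixMultiplication.OmegaCensus
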